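import Summits.AtomisticToContinuum.HydrodynamicLimit.Theses.RelayRaceLocality

/-!
# Crux `LightConeInLaw` (stmt-AtomisticToContinuum-12500) — ideator 5 (round 2), first lemmas

Idea card `clean-territory-island` (this folder, `idea-clean-territory-island.md`).

* `IslandNoSignalling` — the ISLAND RUNG of the crux: `LightConeInLaw` verbatim with ONE extra
  hypothesis after the agreement clause, namely that the common reduced data on the ball
  `B(x₀, R)` are CONSTANT, `(ρσ³, U, Θ)(0, ·) ≡ (r̄, 0, θ̄)` there (an equilibrium island inside two
  arbitrary non-equilibrium exteriors with arbitrary particle numbers). A special case of the crux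
  (`islandNoSignalling_of_lightConeInLaw`, proved by weakening), strictly beyond the two landed
  rungs (homogeneous pair `stub_equilibrium` p101746; global cover `cone_global_of_cover` p124132):
  here the exteriors are inhomogeneous and the regime is local (`R < 1`, `t > 0`).
* `TwoRunChainLocality` — the deterministic CLEAN/DIRTY lemma of the card (typed, not proved
  here): for two hard-sphere trajectories of the same diameter with a set of MATCHED particles
  that start in the same states, a matched particle whose two states differ at time `t` is the
  end of a time-ordered chain of matched particles, consecutive ones in CONTACT in one of the two
  runs, whose first member touched an UNMATCHED particle. (Clean–clean collisions are common to
  both runs, so disagreement is carried only by dirty or unmatched particles.)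
-/

namespace Summit.AtomisticToContinuum.HydrodynamicLimit.Cruxes.LightConeInLaw.IdeatorFive

open scoped BigOperators Topology Classical ENNReal
open Filter Set MeasureTheory
open Literature.MathematicalPhysics.KineticTheory Literature.Analysis.FluidPDE
open Summit.AtomisticToContinuum.HydrodynamicLimit.Theses.RelayRaceLocality

noncomputable section

/-- **ISLAND RUNG of `LightConeInLaw`** (first lemma of card `clean-territory-island`): the crux
verbatim, restricted — by one extra hypothesis inserted after the agreement clause — to pairs of
gases whose common reduced data on `B(x₀, R)` are the CONSTANTS `(r̄, 0, θ̄)` (equilibrium island;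
exteriors, particle numbers `N + 1` / `n₂ N` and the reduced diameters `σ₁, σ₂` arbitrary as in the
crux). Conclusion unchanged: cone observables of the two gases merge. [folklore] -/
def IslandNoSignalling : Prop :=
  open Literature.MathematicalPhysics.KineticTheory Literature.Analysis.FluidPDE MeasureTheory Filter in ∃ η₀ : ℝ, 0 < η₀ ∧ ∀ M : ℝ, 0 < M → ∃ c : ℝ, 0 < c ∧ ∀ (a₁ θ₁ a₂ θ₂ : T3 → ℝ) (u₁ u₂ : T3 → V3), Continuous a₁ → Continuous θ₁ → Continuous u₁ → Continuous a₂ → Continuous θ₂ → Continuous u₂ → (∀ x, 0 < a₁ x) → (∀ x, 0 < θ₁ x) → (∀ x, 0 < a₂ x) → (∀ x, 0 < θ₂ x) → ∃ σ₀ : ℝ, 0 < σ₀ ∧ ∀ (σ₁ σ₂ : ℝ), 0 < σ₁ → σ₁ < σ₀ → 0 < σ₂ → σ₂ < σ₀ → ∀ n₂ : ℕ → ℕ, Tendsto (fun N => (n₂ N : ℝ) * hsDiameter σ₁ N ^ 3) atTop (nhds (σ₂ ^ 3)) → ∀ (T₁ T₂ : ℝ) (ρ₁ Θ₁ ρ₂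 Θ₂ : ℝ → T3 → ℝ) (U₁ U₂ : ℝ → T3 → V3), IsHardSphereEulerSolution σ₁ T₁ ρ₁ U₁ Θ₁ → IsHardSphereEulerSolution σ₂ T₂ ρ₂ U₂ Θ₂ → ∀ (Φ₁ : (N : ℕ) → HardSphereFlow (Torus.geometry (Fin 3)) (hsDiameter σ₁ N) (N + 1)) (Φ₂ : (N : ℕ) → HardSphereFlow (Torus.geometry (Fin 3)) (hsDiameter σ₁ N) (n₂ N)), let P₁ : (N : ℕ) → Measure (Config (N + 1) (Fin 3) T3) := fun N => localGibbsLaw σ₁ a₁ u₁ θ₁ N (Φ₁ N); let P₂ : (N : ℕ) → Measure (Config (n₂ N) (Fin 3) T3) := fun N => particleLaw (Φ₂ N) (canonicalDensity (Torus.geometry (Fin 3)) (hsDiameter σ₁ N) (n₂ N) (localGibbsProfile a₂ u₂ θ₂)); (∀ N, IsProbabilityMeasure (P₁ N)) → (∀ N, IsProbabilityMeasure (P₂ N)) → TendstoHydroFieldsAt P₁ Φ₁ ρ₁ U₁ Θ₁ 0 → (∀ χ : T3 → ℝ, Continuous χ → ∀ δ : ℝ, 0 < δ → Tendsto (fun N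 => P₂ N {z | δ < |empiricalDensityField ((Φ₂ N).flow 0 z) χ - ∫ x, χ x * ρ₂ 0 x|}) atTop (nhds 0) ∧ Tendsto (fun N => P₂ N {z | δ < ‖empiricalMomentumField ((Φ₂ N).flow 0 z) χ - ∫ x, (χ x * ρ₂ 0 x) • U₂ 0 x‖}) atTop (nhds 0) ∧ Tendsto (fun N => P₂ N {z | δ < |empiricalEnergyField ((Φ₂ N).flow 0 z) χ - ∫ x, χ x * totalEnergyDensity (ρ₂ 0 x) (U₂ 0 x) (Θ₂ 0 x)|}) atTop (nhds 0)) → ∀ t : ℝ, 0 ≤ t → t < T₁ → t < T₂ → (∀ s ∈ Set.Icc 0 t, ∀ x, ρ₁ s x * σ₁ ^ 3 < η₀ ∧ Θ₁ s x ≤ M ∧ ‖U₁ s x‖ ≤ M ∧ ρ₂ s x * σ₂ ^ 3 < η₀ ∧ Θ₂ s x ≤ M ∧ ‖U₂ s x‖ ≤ M) → ∀ (x₀ : T3) (R : ℝ), (∀ x, Torus.euclidDist x x₀ < R → ρ₁ 0 x * σ₁ ^ 3 = ρ₂ 0 x * σ₂ ^ 3 ∧ U₁ 0 x = U₂ 0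 x ∧ Θ₁ 0 x = Θ₂ 0 x) → (∃ rbar θbar : ℝ, ∀ x, Torus.euclidDist x x₀ < R → ρ₁ 0 x * σ₁ ^ 3 = rbar ∧ U₁ 0 x = 0 ∧ Θ₁ 0 x = θbar) → ∀ χ : T3 → ℝ, Continuous χ → (∀ x, R - c * t ≤ Torus.euclidDist x x₀ → χ x = 0) → ∀ F : ℝ × V3 × ℝ → ℝ, LipschitzWith 1 F → (∀ p, |F p| ≤ 1) → Tendsto (fun N => (∫ z, F (σ₁ ^ 3 * empiricalDensityField ((Φ₁ N).flow t z) χ, (σ₁ ^ 3) • empiricalMomentumField ((Φ₁ N).flow t z) χ, σ₁ ^ 3 * empiricalEnergyField ((Φ₁ N).flow t z) χ) ∂(P₁ N)) - ∫ z, F (σ₂ ^ 3 * empiricalDensityField ((Φ₂ N).flow t z) χ, (σ₂ ^ 3) • empiricalMomentumField ((Φ₂ N).flow t z) χ, σ₂ ^ 3 * empiricalEnergyField ((Φ₂ N).flow t z) χ) ∂(P₂ N)) atTop (nhds 0)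

/-- The island rung is a special case of the crux (drop the extra hypothesis). [folklore] -/
theorem islandNoSignalling_of_lightConeInLaw (h : LightConeInLaw) : IslandNoSignalling := by
  obtain ⟨η₀, hη₀, h⟩ := h
  refine ⟨η₀, hη₀, fun M hM => ?_⟩
  obtain ⟨c, hc, h⟩ := h M hM
  refine ⟨c, hc, ?_⟩
  intro a₁ θ₁ a₂ θ₂ u₁ u₂ ha₁ hθ₁ hu₁ ha₂ hθ₂ hu₂ pa₁ pθ₁ pa₂ pθ₂
  obtain ⟨σ₀, hσ₀, h⟩ := h a₁ θ₁ a₂ θ₂ u₁ u₂ ha₁ hθ₁ hu₁ ha₂ hθ₂ hu₂ pa₁ pθ₁ pa₂ pθ₂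
  refine ⟨σ₀, hσ₀, ?_⟩
  intro σ₁ σ₂ h1 h2 h3 h4 n₂ hn₂ T₁ T₂ ρ₁ Θ₁ ρ₂ Θ₂ U₁ U₂ hE₁ hE₂ Φ₁ Φ₂ P₁ P₂ hP₁ hP₂ hL₁ hL₂ t ht0 ht1 ht2
    hguard x₀ R hagree _hisland χ hχ hsupp F hF hF1
  exact h σ₁ σ₂ h1 h2 h3 h4 n₂ hn₂ T₁ T₂ ρ₁ Θ₁ ρ₂ Θ₂ U₁ U₂ hE₁ hE₂ Φ₁ Φ₂ hP₁ hP₂ hL₁ hL₂ t ht0 ht1 ht2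
    hguard x₀ R hagree χ hχ hsupp F hF hF1

/-- **TWO-RUN CHAIN LOCALITY (deterministic clean/dirty lemma; typed first lemma, not proved
here).** Two hard-sphere trajectories `γ` (`n` spheres) and `γ'` (`n'` spheres) of the SAME
diameter `ε` on `𝕋³`; `m` MATCHED particles, embedded by injections `e`, `e'`, start in the same
states: `γ 0 (e k) = γ' 0 (e' k)`. If at a time `t ≥ 0` the matched particle `k₀` is DIRTY
(`γ t (e k₀) ≠ γ' t (e' k₀)`), then there is a chain of matched particles `q 0, …, q L = k₀` with
monotone times `0 < s 0 ≤ … ≤ s L ≤ t` such that the first member is in contact, at time `s 0`, with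
an UNMATCHED particle in one of the two runs (the seed), and consecutive members `q l`, `q (l+1)` are
in contact at time `s (l+1)` in run `γ` or in run `γ'` (the links). Reason: a matched particle that
is clean up to time `s` can change its common state only through a collision present in one run
and absent or different in the other; a collision with a CLEAN matched partner is present and
identical in both runs (same pre-collisional pair state, same elastic law, single pair per
collision time), so the partner is unmatched or already dirty — induction on the finitely many
collision times in `[0, t]`. Combined leg by leg with the one-run span budget
`LogWindowTaggedTail.stub_chainSpanBudget` (tree, proved) it bounds how far disagreement travels by
the path lengths of the DIRTY carriers only. [folklore] -/
def TwoRunChainLocality : Prop :=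
  ∀ (n n' m : ℕ) (ε : ℝ) (γ : ℝ → Config n (Fin 3) T3) (γ' : ℝ → Config n' (Fin 3) T3),
    IsHardSphereTrajectory (Torus.geometry (Fin 3)) ε n γ →
    IsHardSphereTrajectory (Torus.geometry (Fin 3)) ε n' γ' →
    ∀ (e : Fin m → Fin n) (e' : Fin m → Fin n'), Function.Injective e → Function.Injective e' →
    (∀ k, γ 0 (e k) = γ' 0 (e' k)) →
    ∀ t : ℝ, 0 ≤ t → ∀ k₀ : Fin m, γ t (e k₀) ≠ γ' t (e' k₀) →
      ∃ (L : ℕ) (q : Fin (L + 1) → Fin m) (s : Fin (L + 1) → ℝ),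
        q (Fin.last L) = k₀ ∧ Monotone s ∧ (∀ l, 0 < s l ∧ s l ≤ t) ∧
        ((∃ i : Fin n, i ∉ Set.range e ∧
            γ (s 0) ∈ contactSet (Torus.geometry (Fin 3)) n ε (e (q 0)) i) ∨
          (∃ i' : Fin n', i' ∉ Set.range e' ∧
            γ' (s 0) ∈ contactSet (Torus.geometry (Fin 3)) n' ε (e' (q 0)) i')) ∧
        (∀ l : Fin L,
          γ (s l.succ) ∈ contactSet (Torus.geometry (Fin 3)) n ε (e (q l.castSucc)) (e (q l.succ)) ∨
          γ' (s l.succ) ∈ contactSet (Torus.geometry (Fin 3)) n' ε (e' (q l.castSucc)) (e' (q l.succ)))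

end

end Summit.AtomisticToContinuum.HydrodynamicLimit.Cruxes.LightConeInLaw.IdeatorFive
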